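import Literature.IUT.HodgeArakelov.CohomologyLimitKummer
import Literature.AnabelianGeometry.AbsoluteAnabelian.MonoidKummerEquivariantModel

/-!
# The Kummer map into the genuine cohomology limit at the MLF MODEL: discharge of its three inputs
# (open stabilisers, finite-index stabilisers, "no invariant compatible roots ≠ 1") for `A = k̄ˣ`

Proof-companion (abc-iut cell, D-0067 wave 4, seat abc-iut-w4-d007, layer L6/L4; GAP-LEDGER **G-w4d019-1**) of
`CohomologyLimitKummer.lean`: there, the Kummer map `h1LimKummer c hA hfi : A →* Multiplicative (h1Lim φ A' H ⊥)` of
a discrete rootable `Π`-module `A` into abc-iut-L6-t1's continuous cohomology limit is constructed for ANY `Π`,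
and its injectivity is proved from the input `hroots` ("no `b ≠ 1` has a compatible root system fixed by some
`H ⊓ K`, `K` finite-index open").  HERE `Π := Π_k` and `A := k̄ˣ` of abc-iut-L4's [AbsTopIII] Def. 3.1 (i) MODEL
(`MLFClosure C`: an MLF `k` with algebraic closure `k̄ = C.K`; `ModelMLFGaloisData D`: a topological group `Π_k`
with a continuous surjection `ε_k : Π_k ↠ G_k = Gal(k̄/k)`, acting on `k̄ˣ` through `ε_k`), and the three inputs
are THEOREMS:
* `isOpen_stabilizer_units` (`hA`): the stabiliser of `u ∈ k̄ˣ` in `Π_k` is open — it is `ε_k⁻¹` of the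
  stabiliser in `G_k`, which contains the open subgroup `Gal(k̄/k(u))` (Krull topology);
* `finiteIndex_stabilizer_units` (`hfi`): it has finite index — `[G_k : Gal(k̄/k(u))] = [k(u) : k] < ∞` and `ε_k`
  is surjective;
* `units_eq_one_of_isInvariant` (`hroots`): for a subgroup `H ≤ Π_k` whose image `ε_k(H) ≤ G_k` has FINITE
  INDEX (e.g. `H = Π_k`; at the tempered model `H = Π_Ÿ`, whose image is open) and `K ≤ Π_k` of finite index,
  a unit `u ∈ k̄ˣ` with a compatible system of roots all fixed by `H ⊓ K` is `1`: `ε_k(H ⊓ K)` has finite index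
  (`finiteIndex_map_inf`), so its closure is open and the points it fixes lie in a FINITE extension `k′/k`
  (`exists_finiteDimensional_forall_mem_of_fixed`), where `⋂ₙ (k′ˣ)ⁿ = 1` (abc-iut-L4
  `MLFClosure.eq_one_of_forall_pos_exists_pow_eq`, [AbsTopIII] Rmk. 1.5.4 (i)).
Hence `h1LimKummer_injective_mlf`: for every change of coefficient cyclotome `c : Λ(k̄ˣ) ⥲ A'` (bijective
`CyclotomeCoefficients`, the cyclotomic-rigidity datum), the Kummer map `k̄ˣ → lim_K H¹(H ⊓ K, A')` is INJECTIVE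
("`Ψ_cns := M_TM ⊆ lim_J H¹(Π_Ÿ|_J, Π_μ)`", [IUTchII] Prop. 3.1 (ii) p. 88; "a natural inclusion
`M^×_TM(Π) ↪ lim_J H¹(J, (l·Δ_Θ)(Π))`", Cor. 1.12 (c) p. 56), and `h1LimKummerConstants` — its restriction to the
constants `𝒪_k̄^▷` along `toUnitHom` — is an injective `Π_k`-equivariant monoid homomorphism whose image is stable.
S. Mochizuki, *Topics in absolute anabelian geometry III*, Def. 3.1 (i) p. 66, Prop. 3.2 (ii) p. 71, Rmk. 1.5.4 (i)
p. 33 [cite: MochizukiAbsTopIII2015, Proposition 3.2 (ii) p.71]; *Inter-universal Teichmüller theory II*,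
Prop. 3.1 (ii) p. 88 [cite: Mochizuki2012, Prop 3.1 (ii) p.88] (claim key DISPUTED, D-0012 — only the interface
is the author's; the mathematics here is classical Kummer/Galois theory over Mathlib's Krull topology and
infinite Galois correspondence).  No Prop fact; nothing here bears on [IUTchIII] Cor. 3.12; typed ≠ proved.
-/

namespace Literature.IUT.HodgeArakelov

open Literature.AnabelianGeometry.EtaleTheta Literature.AnabelianGeometry.AbsoluteAnabelian
open CohomologySystemOfContH1

noncomputable section

namespace CohomologySystemOfContH1

/-! ### Group theory: the image of `H ⊓ K` has finite index -/

/-- If `f(H)` has finite index in the target and `K` has finite index in the source, then `f(H ⊓ K)` has finite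
index in the target (`H ⊓ K` has finite index in `H`; `[f(H) : f(H ⊓ K)] ≤ [H : H ⊓ K]`).
[cite: NeukirchSchmidtWingberg2008, I §5] -/
theorem finiteIndex_map_inf {G G₁ : Type*} [Group G] [Group G₁] (f : G →* G₁) (H K : Subgroup G)
    [hH : (H.map f).FiniteIndex] [K.FiniteIndex] : ((H ⊓ K).map f).FiniteIndex := by
  constructor
  have h1 : H ⊓ K = (K.subgroupOf H).map H.subtype := by
    rw [Subgroup.subgroupOf_map_subtype, inf_comm]
  rw [h1, Subgroup.map_map, Subgroup.index_map, MonoidHom.range_comp, Subgroup.range_subtype]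
  refine mul_ne_zero ?_ hH.index_ne_zero
  exact ne_zero_of_dvd_ne_zero (Subgroup.FiniteIndex.index_ne_zero (H := K.subgroupOf H))
    (Subgroup.index_dvd_of_le le_sup_left)

/-- For `f` surjective, `f(⊤)` has finite index (it is everything). [cite: NeukirchSchmidtWingberg2008, I §5] -/
theorem finiteIndex_map_top_of_surjective {G G₁ : Type*} [Group G] [Group G₁] (f : G →* G₁)
    (hf : Function.Surjective f) : ((⊤ : Subgroup G).map f).FiniteIndex := by
  rw [← MonoidHom.range_eq_map, MonoidHom.range_eq_top_of_surjective f hf]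
  infer_instance

/-! ### Galois side: stabilisers in `G_k` and in `Π_k` -/

variable (C : MLFClosure.{0}) (D : ModelMLFGaloisData C.k C.K)

/-- `Gal(k̄/k(x))` fixes `x`: the fixing subgroup of `k(x)` lies in the stabiliser of `x`.
[cite: MochizukiAbsTopIII2015, Definition 3.1 (i) p.66] -/
theorem fixingSubgroup_adjoin_le_stabilizer (x : C.K) :
    (IntermediateField.adjoin C.k ({x} : Set C.K)).fixingSubgroup ≤ MulAction.stabilizer (C.K ≃ₐ[C.k] C.K) x := by
  intro σ hσ
  rw [IntermediateField.mem_fixingSubgroup_iff] at hσ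
  exact hσ x (IntermediateField.subset_adjoin C.k ({x} : Set C.K) (Set.mem_singleton x))

/-- `k(x)/k` is finite (`k̄/k` is algebraic). [cite: MochizukiAbsTopIII2015, Definition 3.1 (i) p.66] -/
theorem finiteDimensional_adjoin_singleton (x : C.K) :
    FiniteDimensional C.k (IntermediateField.adjoin C.k ({x} : Set C.K)) :=
  IntermediateField.adjoin.finiteDimensional (Algebra.IsIntegral.isIntegral x)

/-- The stabiliser of `x ∈ k̄` in `G_k` is OPEN (Krull topology). [cite: MochizukiAbsTopIII2015, Definition 3.1 (i) p.66] -/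
theorem isOpen_stabilizer_gal (x : C.K) :
    IsOpen (MulAction.stabilizer (C.K ≃ₐ[C.k] C.K) x : Set (C.K ≃ₐ[C.k] C.K)) :=
  haveI := finiteDimensional_adjoin_singleton C x
  Subgroup.isOpen_mono (fixingSubgroup_adjoin_le_stabilizer C x)
    (IntermediateField.fixingSubgroup_isOpen _)

/-- The stabiliser of `x ∈ k̄` in `G_k` has FINITE INDEX (`≤ [k(x) : k]`).
[cite: MochizukiAbsTopIII2015, Definition 3.1 (i) p.66] -/
theorem finiteIndex_stabilizer_gal (x : C.K) : (MulAction.stabilizer (C.K ≃ₐ[C.k] C.K) x).FiniteIndex := by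
  haveI := finiteDimensional_adjoin_singleton C x
  haveI : (IntermediateField.adjoin C.k ({x} : Set C.K)).fixingSubgroup.FiniteIndex := by
    refine ⟨?_⟩
    rw [← IntermediateField.finrank_eq_fixingSubgroup_index]
    exact Module.finrank_pos.ne'
  exact Subgroup.finiteIndex_of_le (fixingSubgroup_adjoin_le_stabilizer C x)

/-- The stabiliser of a unit `u ∈ k̄ˣ` in `Π_k` is the preimage under `ε_k` of the stabiliser of `u` in `G_k`.
[cite: MochizukiAbsTopIII2015, Definition 3.1 (i) p.66] -/
theorem stabilizer_units_eq_comap (u : (C.K)ˣ) :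
    MulAction.stabilizer D.Pi u = (MulAction.stabilizer (C.K ≃ₐ[C.k] C.K) (u : C.K)).comap D.aug := by
  ext g
  rw [MulAction.mem_stabilizer_iff, Subgroup.mem_comap, MulAction.mem_stabilizer_iff, Units.ext_iff,
    ModelMLFGaloisData.units_coe_smul]

/-- **Input `hA` at the model**: the stabiliser in `Π_k` of every unit of `k̄` is OPEN (`ε_k` continuous).
[cite: MochizukiAbsTopIII2015, Definition 3.1 (i) p.66] -/
theorem isOpen_stabilizer_units (u : (C.K)ˣ) : IsOpen (MulAction.stabilizer D.Pi u : Set D.Pi) := by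
  rw [stabilizer_units_eq_comap, Subgroup.coe_comap]
  exact (isOpen_stabilizer_gal C (u : C.K)).preimage D.continuous_aug

/-- **Input `hfi` at the model**: the stabiliser in `Π_k` of every unit of `k̄` has FINITE INDEX (`ε_k` surjective).
[cite: MochizukiAbsTopIII2015, Definition 3.1 (i) p.66] -/
theorem finiteIndex_stabilizer_units (u : (C.K)ˣ) : (MulAction.stabilizer D.Pi u).FiniteIndex := by
  rw [stabilizer_units_eq_comap]
  refine ⟨?_⟩
  have h := Subgroup.index_comap_of_surjective (MulAction.stabilizer (C.K ≃ₐ[C.k] C.K) (u : C.K))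
    D.aug_surjective
  rw [h]
  exact (finiteIndex_stabilizer_gal C (u : C.K)).index_ne_zero

/-! ### Points fixed by a subgroup with finite-index image lie in a finite extension -/

/-- If `ε_k(S) ≤ G_k` has finite index, there is a FINITE extension `k′ ⊆ k̄` of `k` containing every `x ∈ k̄`
fixed by `S` (the closure of `ε_k(S)` is closed of finite index, hence open, hence contains `Gal(k̄/k′)` for a
finite `k′`; stabilisers of points are closed, so `Gal(k̄/k′)` fixes `x`, i.e. `x ∈ k′` by the Galois
correspondence). [cite: MochizukiAbsTopIII2015, Rmk 1.5.4 (i) p.33] -/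
theorem exists_finiteDimensional_forall_mem_of_fixed (S : Subgroup D.Pi) [hS : (S.map D.aug).FiniteIndex] :
    ∃ E : IntermediateField C.k C.K, FiniteDimensional C.k E ∧
      ∀ x : C.K, (∀ g : D.Pi, g ∈ S → D.aug g x = x) → x ∈ E := by
  set Γ : Subgroup (C.K ≃ₐ[C.k] C.K) := (S.map D.aug).topologicalClosure with hΓ
  haveI : Γ.FiniteIndex := Subgroup.finiteIndex_of_le (Subgroup.le_topologicalClosure _)
  have hΓo : IsOpen (Γ : Set (C.K ≃ₐ[C.k] C.K)) :=
    Subgroup.isOpen_of_isClosed_of_finiteIndex Γ (Subgroup.isClosed_topologicalClosure _)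
  obtain ⟨E, hEfin, hEsub⟩ :=
    (krullTopology_mem_nhds_one_iff C.k C.K _).mp (hΓo.mem_nhds (Subgroup.one_mem Γ))
  haveI : FiniteDimensional C.k E := hEfin
  refine ⟨E, hEfin, fun x hx => ?_⟩
  -- the stabiliser of `x` is closed and contains `ε_k(S)`, hence `Γ`, hence `Gal(k̄/E)`
  have hstab : Γ ≤ MulAction.stabilizer (C.K ≃ₐ[C.k] C.K) x := by
    refine Subgroup.topologicalClosure_minimal _ ?_
      (Subgroup.isClosed_of_isOpen _ (isOpen_stabilizer_gal C x))
    rintro _ ⟨g, hg, rfl⟩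
    exact hx g hg
  rw [← InfiniteGalois.fixedField_fixingSubgroup E, IntermediateField.mem_fixedField_iff]
  intro σ hσ
  exact hstab (hEsub hσ)

/-- **Input `hroots` at the model**: for `H ≤ Π_k` with `ε_k(H)` of finite index and `K ≤ Π_k` of finite index,
a unit of `k̄` admitting a compatible system of roots ALL FIXED by `H ⊓ K` is `1` (the roots lie in a finite
`k′/k`, and `⋂ₙ (k′ˣ)ⁿ = 1`). [cite: MochizukiAbsTopIII2015, Rmk 1.5.4 (i) p.33] -/
theorem units_eq_one_of_isInvariant (H K : Subgroup D.Pi) [(H.map D.aug).FiniteIndex] [K.FiniteIndex]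
    (u : (C.K)ˣ) (y : RootSystem u) (hy : y.IsInvariant (H ⊓ K)) : u = 1 := by
  haveI := finiteIndex_map_inf D.aug H K
  obtain ⟨E, hE, hmem⟩ := exists_finiteDimensional_forall_mem_of_fixed C D (H ⊓ K)
  haveI : FiniteDimensional C.k E := hE
  have hroot : ∀ n : ℕ+, ((y.root n : (C.K)ˣ) : C.K) ∈ E := fun n =>
    hmem _ fun g hg => by
      have h := congrArg (fun v : (C.K)ˣ => (v : C.K)) (hy n ⟨g, hg⟩)
      simpa [ModelMLFGaloisData.units_coe_smul, AlgEquiv.smul_def] using h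
  have hu : ((u : (C.K)ˣ) : C.K) ∈ E := by
    have h := hroot 1
    rwa [y.root_one] at h
  refine Units.ext (MLFClosure.eq_one_of_forall_pos_exists_pow_eq C E hu u.ne_zero fun n hn => ?_)
  refine ⟨(y.root ⟨n, hn⟩ : C.K), hroot ⟨n, hn⟩, ?_⟩
  have h := congrArg (fun v : (C.K)ˣ => (v : C.K)) (y.pow_self ⟨n, hn⟩)
  simpa [Units.val_pow_eq_pow_val] using h

/-! ### Assembly: the Kummer map of `k̄ˣ` / `𝒪_k̄^▷` into `lim_K H¹(H ⊓ K, A')` at the model -/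

section Assembly

variable {G' : Type} [Group G'] [TopologicalSpace G'] [IsTopologicalGroup G']
  (φ : (TopGroup.of D.Pi) →* G') (A' : Subgroup G') [A'.Normal] [IsMulCommutative A']
  (H : Subgroup (TopGroup.of D.Pi)) [TopologicalSpace (C.K)ˣ]
  (c : CyclotomeCoefficients φ A' (C.K)ˣ)

/-- **Injectivity of the Kummer map of `k̄ˣ` into the genuine limit at the MLF model**: for every subgroup
`H ≤ Π_k` whose image in `G_k` has finite index, every coefficient group `A'` and every BIJECTIVE change of
coefficient cyclotome `c : Λ(k̄ˣ) ⥲ A'` (the cyclotomic-rigidity datum), `h1LimKummer` is injective — "`⊆`" /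
"a natural inclusion". (Any topology on `k̄ˣ` may be used to topologise `Λ(k̄ˣ)`; `c` records the continuity.)
[cite: Mochizuki2012, Prop 3.1 (ii) p.88] -/
theorem h1LimKummer_injective_mlf [(Subgroup.map D.aug H).FiniteIndex] (hc : Function.Bijective c.hom) :
    Function.Injective (h1LimKummer φ A' H c (isOpen_stabilizer_units C D) (finiteIndex_stabilizer_units C D)) :=
  h1LimKummer_injective_of_forall_isInvariant_eq_one φ A' H c _ _ hc fun K hK _ u y hy =>
    haveI : K.FiniteIndex := hK
    units_eq_one_of_isInvariant C D H K u y hy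

/-- The same for `H = Π_k` itself ("`lim_J H¹(J, ·)`", `J` ranging over ALL finite-index open subgroups —
Cor. 1.12 (c)): no hypothesis beyond bijectivity of `c`. [cite: Mochizuki2012, Cor 1.12 p.56] -/
theorem h1LimKummer_top_injective_mlf (cT : CyclotomeCoefficients φ A' (C.K)ˣ) (hc : Function.Bijective cT.hom) :
    Function.Injective (h1LimKummer φ A' (⊤ : Subgroup (TopGroup.of D.Pi)) cT (isOpen_stabilizer_units C D)
      (finiteIndex_stabilizer_units C D)) :=
  haveI : (Subgroup.map D.aug (⊤ : Subgroup (TopGroup.of D.Pi))).FiniteIndex :=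
    finiteIndex_map_top_of_surjective D.aug D.aug_surjective
  h1LimKummer_injective_mlf C D φ A' ⊤ cT hc

/-- **The Kummer map of the constants `𝒪_k̄^▷` into the genuine limit** ("`Ψ_cns(M^Θ_*) := M_TM(M^Θ_*) ⊆
lim_J H¹(Π_Ÿ(M^Θ_*)|_J, Π_μ(M^Θ_*))`"): `h1LimKummer` precomposed with `𝒪_k̄^▷ → k̄ˣ` (abc-iut-L4 `toUnitHom`).
[cite: Mochizuki2012, Prop 3.1 (ii) p.88] -/
def h1LimKummerConstants : nonzeroIntegers C.k C.K →* Multiplicative (h1Lim φ A' H ⊥) where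
  toFun m := h1LimKummer φ A' H c (isOpen_stabilizer_units C D) (finiteIndex_stabilizer_units C D)
    (ModelMLFGaloisData.toUnit m)
  map_one' := by
    have h1 : ModelMLFGaloisData.toUnit (1 : nonzeroIntegers C.k C.K) = 1 := Units.ext rfl
    rw [h1, map_one]
  map_mul' m m' := by
    rw [ModelMLFGaloisData.toUnit_mul, map_mul]

/-- `h1LimKummerConstants` on elements. [cite: Mochizuki2012, Prop 3.1 (ii) p.88] -/
theorem h1LimKummerConstants_apply (m : nonzeroIntegers C.k C.K) :
    h1LimKummerConstants C D φ A' H c m =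
      h1LimKummer φ A' H c (isOpen_stabilizer_units C D) (finiteIndex_stabilizer_units C D)
        (ModelMLFGaloisData.toUnit m) := rfl

/-- **Injectivity** of the Kummer map of the constants ("`M_TM ⊆ lim_J H¹(…)`").
[cite: Mochizuki2012, Prop 3.1 (ii) p.88] -/
theorem h1LimKummerConstants_injective [(Subgroup.map D.aug H).FiniteIndex] (hc : Function.Bijective c.hom) :
    Function.Injective (h1LimKummerConstants C D φ A' H c) :=
  (h1LimKummer_injective_mlf C D φ A' H c hc).comp ModelMLFGaloisData.toUnit_injective

/-- **`Π_k`-equivariance** of the Kummer map of the constants w.r.t. the conjugation action on the limit (`H`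
normal): `κ(g • m) = (h1LimConjMulAut g)(κ m)` — the hypothesis `hκ` of the consumer theorems of
`TemperedThetaMonoidsProofs2/3.lean`, now a THEOREM. [cite: Mochizuki2012, Prop 3.1 (ii) p.88] -/
theorem h1LimKummerConstants_smul [H.Normal] (g : D.Pi) (m : nonzeroIntegers C.k C.K) :
    h1LimKummerConstants C D φ A' H c (g • m) = h1LimConjMulAut φ A' H g (h1LimKummerConstants C D φ A' H c m) := by
  rw [h1LimKummerConstants_apply, h1LimKummerConstants_apply, ← ModelMLFGaloisData.smul_toUnit]
  exact h1LimKummer_smul φ A' H c _ _ g _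

/-- The image `Ψ_cns := mrange κ` of the constants is STABLE under the conjugation action of `Π_k` on the limit
("equipped with a natural conjugation action by `Π_X(M^Θ_*)`"). [cite: Mochizuki2012, Prop 3.1 (ii) p.88] -/
theorem mrange_h1LimKummerConstants_stable [H.Normal] (g : D.Pi) (y : Multiplicative (h1Lim φ A' H ⊥))
    (hy : y ∈ MonoidHom.mrange (h1LimKummerConstants C D φ A' H c)) :
    h1LimConjMulAut φ A' H g y ∈ MonoidHom.mrange (h1LimKummerConstants C D φ A' H c) := by
  obtain ⟨m, rfl⟩ := hy
  exact ⟨g • m, h1LimKummerConstants_smul C D φ A' H c g m⟩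

/-- "**naturally isomorphic to `O^▷_{F̄_v}`**": `𝒪_k̄^▷ ≃*` its Kummer image `Ψ_cns` in the genuine limit, the
isomorphism being `κ` on elements. [cite: Mochizuki2012, Prop 3.1 (ii) p.88] -/
theorem exists_mulEquiv_mrange_h1LimKummerConstants [(Subgroup.map D.aug H).FiniteIndex]
    (hc : Function.Bijective c.hom) :
    ∃ e : nonzeroIntegers C.k C.K ≃* MonoidHom.mrange (h1LimKummerConstants C D φ A' H c),
      ∀ m, ((e m : MonoidHom.mrange (h1LimKummerConstants C D φ A' H c)) : Multiplicative (h1Lim φ A' H ⊥)) =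
        h1LimKummerConstants C D φ A' H c m :=
  ⟨MulEquiv.ofBijective (h1LimKummerConstants C D φ A' H c).mrangeRestrict
      ⟨fun _ _ e => h1LimKummerConstants_injective C D φ A' H c hc (congrArg Subtype.val e),
        (h1LimKummerConstants C D φ A' H c).mrangeRestrict_surjective⟩,
    fun _ => rfl⟩

end Assembly

end CohomologySystemOfContH1

end

end Literature.IUT.HodgeArakelov
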